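import Summits.QuantumFields.YangMills.Theorems.BalabanUVNodesN15KingModelHeatKernelGreenPowerLawEtaUniform
import HarnessLib

/-!
# BalabanUVNodes ∕ N15 — THE KING-MODEL RUNG (PART Ϣ-j): THE TORUS-DISTANCE DICTIONARY FOR PART Ϣ —
# `tdistT K x y = max_ν |v((x−y)_ν)|`; hence `c·|G(x,y)| ≤ 34016∕(1 + tdistT(x,y)²) + 8c∕(m²K₀⁴)`, `L²|G(x,y)| ≤ (34016 + 10∕m²)∕(1 + tdistT(x,y)²)`, and the η-uniform decaying decoupling under Ϯ-l's hypothesis `tdistT ≥ D`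
# (Track A, DAG node N15 = NE2; FAN-OUT v1.1 §N15 s3 «KING-MODEL RUNG … + what the curved case adds»; count-neutral)

HONEST FRAMING.  Count-neutral (cell `pub-ymgap`, seat `pub-ymgap-dag-n15-e` g55; `--supports stmt-QuantumFields-27247 --as helper` = K3ᴬ).  PARTS Ϣ-h∕Ϣ-i state the power law per COORDINATE of
the difference (`|v((x−y)_ν)|`, `v = valMinAbs`); this lineage's decay statements (Ε-d, Ϛ-d, Ϯ-l) use the torus sup-distance `tdistT K x y = max_μ dist(x_μ − y_μ, K_μℤ)`
(`King1986.Torus.tdistT`, built on `B4Sect5Torus.tdist`∕`ccoord`∕`B4TorusKernel.circAbs`).  THIS FILE is the dictionary (door t2⁶¹ of HANDOFF §g55): ★ `circAbs_val_sub_val` (the circular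
distance of the `val`-representatives is `|valMinAbs(a − b)|`), ★ `natAbs_valMinAbs_le_tdistT`, ★★ **`exists_tdistT_eq_natAbs_valMinAbs`** (`tdistT K x y = |v((x−y)_ν)|` for SOME ν — the
sup is attained), `exists_coord_ge_of_le_tdistT`; then PART Ϣ in the lineage's currency: ★★★★ **`mul_abs_lapF_inv_le_powerLaw_tdistT`** (cubic four-torus), ★★★★ **`king_green_powerLaw_tdistT`**
(King's scaling, η-uniform), ★★★ `norm_covLapF_inv_entry_le_powerLaw_tdistT` (every unitary `U`), ★★★★ **`abs_log_det_covLapF_decoupling_powerLaw_tdistT_eta_uniform`** with EXACTLY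
Ϯ-l's separation hypothesis `∀ endpoints, D ≤ tdistT K x y` AND THE ZERO MODE ABSORBED (`((34016+10∕m²)∕(1+D²))²`, using `D ≤ tdistT ≤ LM₀∕2` when both supports are non-empty; the general-`c` cubic form is Ϣ-i's `abs_log_det_covLapF_decoupling_powerLaw` composed with `exists_coord_ge_of_le_tdistT`) — so Ϯ-l (`O(L⁴∕m⁴)·e^{−2κ_FD∕(d+1)}`), Ϯ-n's η-uniform face (`(5∕4+1∕m²)²`, no decay) and PART Ϣ (`((34016+…)∕(1+D²))²`) are three
bounds for ONE statement.  NOT a node discharge; nothing continuum ∕ Clay.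
PRIOR TREE ART (by name): `King1986.Torus.tdistT`∕`toSite`∕`one_le_period`, `B4Sect5Torus.tdist`∕`ccoord`∕`ccoord_cast`∕`circAbs_le_tdist`, `B4TorusKernel.MultiPeriod.circAbs_add_mul`∕`circAbs_of_centred`∕`circAbs_nonneg`,
Mathlib `ZMod.valMinAbs_mem_Ioc`∕`coe_valMinAbs`∕`intCast_eq_intCast_iff_dvd_sub`, PARTS Ϣ-h∕Ϣ-i.  Ε-d `tdistT_eq_torusSupNorm` is the same dictionary in pv17's variables (`torRepZ`, not `valMinAbs`).
Dedup (rg at filing): basename 0 files; needles `circAbs_val_sub_val|natAbs_valMinAbs_le_tdistT|exists_tdistT_eq_natAbs_valMinAbs|powerLaw_tdistT|exists_coord_ge_of_le_tdistT|tdistT_fine_le_half` 0 tree files; v1 (p836023) BOUNCED `dedup.landed` ×3 — my `tdistT_nonneg'` ≡ `King1986.Torus.tdistT_nonneg` (now cited), and two thin wrappers of Ϣ-i's decoupling theorems (dropped; this v2 keeps only the NEW zero-mode-absorbed form).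
Locators: [King1986] (2.13) p.653, (4.4) p.670 (`|p′_μ| ≤ π`: centred representatives), (4.35) p.674; [Balaban1985BackgroundPropagators] (3.42) p.397, Thm 3.4 p.400.  0 `sorry`, 0 `def`.
-/

noncomputable section

open Real Set Finset Matrix
open scoped BigOperators Matrix.Norms.L2Operator

namespace Summit.QuantumFields.YangMills.BalabanUVNodes.N15KingModelRung.HeatKernel

open Literature.MathematicalPhysics.QuantumFieldTheory.Balaban1983to89.B5Prop11Plancherel (Tor fine unitVec)
open Literature.MathematicalPhysics.QuantumFieldTheory.Balaban1983to89.Beta.WoodburyFibre (cM)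
open Literature.MathematicalPhysics.QuantumFieldTheory.Balaban1983to89.B4TorusKernel.MultiPeriod (circAbs circAbs_add_mul circAbs_of_centred circAbs_nonneg)
open Literature.MathematicalPhysics.QuantumFieldTheory.Balaban1983to89.B4Sect5Torus (tdist ccoord ccoord_cast circAbs_le_tdist)
open Literature.MathematicalPhysics.QuantumFieldTheory.King1986.Torus (lapF tdistT toSite one_le_period tdistT_nonneg)
open Summit.QuantumFields.YangMills.BalabanUVNodes.N15KingModelRung.Covariant (covLapF)

/-! ## §1 The circular distance of the `val`-representatives is `|valMinAbs|` of the difference -/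

/-- ★ `circAbs K (a.val − b.val) = |v(a − b)|` for `a, b ∈ ℤ∕K` (`K ≥ 1`): `a.val − b.val ≡ v(a−b) (mod K)`, `circAbs` is `K`-periodic and equals `|·|` on centred representatives (`2|v| ≤ K`).
[cite: King1986, (4.4) p.670] -/
theorem circAbs_val_sub_val {K : ℕ} [NeZero K] (a b : ZMod K) :
    circAbs K (((a.val : ℕ) : ℤ) - ((b.val : ℕ) : ℤ)) = (((a - b).valMinAbs.natAbs : ℕ) : ℤ) := by
  have hK : 1 ≤ K := Nat.one_le_iff_ne_zero.mpr (NeZero.ne K)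
  set w : ℤ := (a - b).valMinAbs with hw
  -- `a.val − b.val ≡ w (mod K)`
  have hcast : (((a.val : ℕ) : ℤ) - ((b.val : ℕ) : ℤ) : ℤ) = ((((a.val : ℕ) : ℤ) - ((b.val : ℕ) : ℤ) : ℤ)) := rfl
  have h1 : ((((a.val : ℕ) : ℤ) - ((b.val : ℕ) : ℤ) : ℤ) : ZMod K) = ((w : ℤ) : ZMod K) := by
    rw [hw, ZMod.coe_valMinAbs]; push_cast; rw [ZMod.natCast_zmod_val, ZMod.natCast_zmod_val]
  rw [ZMod.intCast_eq_intCast_iff_dvd_sub] at h1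
  obtain ⟨m, hm⟩ := h1
  have e : (((a.val : ℕ) : ℤ) - ((b.val : ℕ) : ℤ)) = w + (K : ℤ) * (-m) := by linarith
  rw [e, circAbs_add_mul]
  -- centred: `2|w| ≤ K`
  have hc : 2 * |w| ≤ (K : ℤ) := by
    have h := ZMod.valMinAbs_mem_Ioc (a - b)
    rw [← hw] at h
    obtain ⟨hlo, hhi⟩ := h
    rcases le_or_gt 0 w with h0 | h0
    · rw [abs_of_nonneg h0]; linarith
    · rw [abs_of_neg h0]; linarith
  rw [circAbs_of_centred hK hc, hw, Int.natCast_natAbs]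

variable {d : ℕ} (K : Fin (d + 1) → ℕ) [hK : ∀ μ, NeZero (K μ)]

/-- ★ Every coordinate's circular distance is below the torus distance: `|v((x−y)_ν)| ≤ tdistT K x y`. [folklore] -/
theorem natAbs_valMinAbs_le_tdistT (x y : Tor K) (ν : Fin (d + 1)) : ((((x - y) ν).valMinAbs.natAbs : ℕ) : ℝ) ≤ tdistT K x y := by
  have h := circAbs_le_tdist (one_le_period K) (toSite K x) (toSite K y) ν
  have e : circAbs (K ν) ((((toSite K x ν).val : ℕ) : ℤ) - (((toSite K y ν).val : ℕ) : ℤ)) = ((((x - y) ν).valMinAbs.natAbs : ℕ) : ℤ) := by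
    exact circAbs_val_sub_val (K := K ν) (x ν) (y ν)
  rw [e] at h
  unfold tdistT
  rw [Int.cast_natCast] at h
  exact h

/-- ★★ **THE SUP IS ATTAINED**: `tdistT K x y = |v((x−y)_ν)|` for some coordinate `ν`. [folklore] -/
theorem exists_tdistT_eq_natAbs_valMinAbs (x y : Tor K) : ∃ ν : Fin (d + 1), tdistT K x y = ((((x - y) ν).valMinAbs.natAbs : ℕ) : ℝ) := by
  obtain ⟨ν, _, hν⟩ := Finset.exists_mem_eq_sup (Finset.univ : Finset (Fin (d + 1))) Finset.univ_nonempty (ccoord K (toSite K x) (toSite K y))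
  refine ⟨ν, ?_⟩
  unfold tdistT tdist
  rw [hν]
  have h1 := ccoord_cast (one_le_period K) (toSite K x) (toSite K y) ν
  have h2 := circAbs_val_sub_val (K := K ν) (x ν) (y ν)
  have e : ((ccoord K (toSite K x) (toSite K y) ν : ℕ) : ℤ) = ((((x - y) ν).valMinAbs.natAbs : ℕ) : ℤ) := by
    rw [h1]; exact h2
  have e' : ccoord K (toSite K x) (toSite K y) ν = ((x - y) ν).valMinAbs.natAbs := by exact_mod_cast e
  rw [e']

/-- `D ≤ tdistT K x y` ⟹ some coordinate of `x − y` has `|v| ≥ D` (the hypothesis shape of PARTS Ϣ-h∕Ϣ-i from the shape of Ε-d∕Ϯ-l). [folklore] -/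
theorem exists_coord_ge_of_le_tdistT {x y : Tor K} {D : ℝ} (hD : D ≤ tdistT K x y) : ∃ ν : Fin (d + 1), D ≤ ((((x - y) ν).valMinAbs.natAbs : ℕ) : ℝ) := by
  obtain ⟨ν, hν⟩ := exists_tdistT_eq_natAbs_valMinAbs K x y
  exact ⟨ν, hν ▸ hD⟩

/-! ## §2 PART Ϣ in the torus-distance currency -/

section Cubic

variable {K₀ : ℕ} [NeZero K₀] {c m2 : ℝ}

/-- ★★★★ **THE POWER LAW IN THE TORUS DISTANCE** (cubic four-torus): `c·|(lapF (cM K₀) c m²)⁻¹(x,y)| ≤ 34016∕(1 + tdistT(x,y)²) + 8c∕(m²K₀⁴)`. [cite: King1986, (2.13) p.653, (4.4) p.670, (4.35) p.674] -/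
theorem mul_abs_lapF_inv_le_powerLaw_tdistT (hc : 0 < c) (hm : 0 < m2) (x y : Tor (cM K₀)) :
    c * |(lapF (cM K₀) c m2)⁻¹ x y| ≤ 34016 / (1 + tdistT (cM K₀) x y ^ 2) + 8 * c / (m2 * (K₀ : ℝ) ^ 4) :=
  mul_abs_lapF_inv_le_of_dist_le hc hm x y (tdistT_nonneg (cM K₀) x y) (exists_coord_ge_of_le_tdistT (cM K₀) le_rfl)

/-- ★★★ The covariant fine covariance at every unitary `U`, torus-distance form. [cite: Balaban1985BackgroundPropagators, Thm 3.4 p.400; King1986, (4.4) p.670] -/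
theorem norm_covLapF_inv_entry_le_powerLaw_tdistT (hc : 0 < c) (hm : 0 < m2) {𝕜 : Type*} [RCLike 𝕜] {n : Type*} [Fintype n] [DecidableEq n]
    {U : Tor (cM K₀) × Fin 4 → Matrix n n 𝕜} (hU : ∀ b, U b ∈ Matrix.unitaryGroup n 𝕜) (x y : Tor (cM K₀)) (i j : n) :
    c * ‖(covLapF (cM K₀) c m2 U)⁻¹ (x, i) (y, j)‖ ≤ 34016 / (1 + tdistT (cM K₀) x y ^ 2) + 8 * c / (m2 * (K₀ : ℝ) ^ 4) := by
  obtain ⟨ν, hν⟩ := exists_tdistT_eq_natAbs_valMinAbs (cM K₀) x y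
  rw [hν]
  exact norm_covLapF_inv_entry_le_powerLaw hc hm hU x y i j ν

end Cubic

section King

variable (L M₀ : ℕ) [NeZero L] [NeZero M₀] {m2 : ℝ}

/-- ★★★★ **THE η-UNIFORM CLUSTER PROPERTY IN THE TORUS DISTANCE**: `L²|G(x,y)| ≤ (34016 + 10∕m²)∕(1 + tdistT(x,y)²)` on `(ℤ∕LM₀)⁴`, every `L ≥ 1`, every volume `M₀ ≥ 1`. [cite: King1986, (2.13) p.653, (4.4) p.670, (4.35) p.674] -/
theorem king_green_powerLaw_tdistT (hm : 0 < m2) (x y : Tor (fine L (cM M₀))) :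
    (L : ℝ) ^ 2 * |(lapF (fine L (cM M₀)) ((L : ℝ) ^ 2) m2)⁻¹ x y| ≤ (34016 + 10 / m2) / (1 + tdistT (fine L (cM M₀)) x y ^ 2) := by
  obtain ⟨ν, hν⟩ := exists_tdistT_eq_natAbs_valMinAbs (fine L (cM M₀)) x y
  rw [hν]
  exact king_green_powerLaw_eta_uniform L M₀ hm x y ν

end King

/-! ## §3 The decoupling under Ϯ-l's separation hypothesis -/

/-- `tdistT ≤ K_ν∕2`-type bound on the cubic torus: `tdistT (fine L (cM M₀)) x y ≤ LM₀∕2`. [folklore] -/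
theorem tdistT_fine_le_half (L M₀ : ℕ) [NeZero L] [NeZero M₀] (x y : Tor (fine L (cM M₀))) : tdistT (fine L (cM M₀)) x y ≤ ((L : ℝ) * M₀) / 2 := by
  obtain ⟨ν, hν⟩ := exists_tdistT_eq_natAbs_valMinAbs (fine L (cM M₀)) x y
  rw [hν]
  have h1 : ((x - y) ν).valMinAbs.natAbs ≤ (L * M₀) / 2 := ZMod.natAbs_valMinAbs_le ((x - y) ν)
  have h2 : ((((x - y) ν).valMinAbs.natAbs : ℕ) : ℝ) ≤ (((L * M₀) / 2 : ℕ) : ℝ) := by exact_mod_cast h1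
  refine h2.trans ?_
  have := Nat.cast_div_le (m := L * M₀) (n := 2) (α := ℝ)
  push_cast at this
  exact this

section DecouplingKing

variable (L M₀ : ℕ) [NeZero L] [NeZero M₀] {n : Type*} [Fintype n] [DecidableEq n] [Nonempty n]
variable {m2 : ℝ} (hm : 0 < m2)
variable {U₀ U₁ U₂ : Tor (fine L (cM M₀)) × Fin 4 → Matrix n n ℝ} (hU₀ : ∀ b, U₀ b ∈ Matrix.unitaryGroup n ℝ) (hU₁ : ∀ b, U₁ b ∈ Matrix.unitaryGroup n ℝ)
  (hU₂ : ∀ b, U₂ b ∈ Matrix.unitaryGroup n ℝ)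
variable {Z₁ Z₂ : Finset (Tor (fine L (cM M₀)) × Fin 4)} (h₁ : ∀ b, b ∉ Z₁ → U₁ b = U₀ b) (h₂ : ∀ b, b ∉ Z₂ → U₂ b = U₀ b) (hZ : Disjoint Z₁ Z₂)
variable {D : ℝ} (hD0 : 0 ≤ D)
  (hsep : ∀ x y : Tor (fine L (cM M₀)), (∃ b ∈ Z₁, x = b.1 ∨ x = b.1 + unitVec (fine L (cM M₀)) b.2) → (∃ b ∈ Z₂, y = b.1 ∨ y = b.1 + unitVec (fine L (cM M₀)) b.2) →
    D ≤ tdistT (fine L (cM M₀)) x y)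
include hm hU₀ hU₁ hU₂ h₁ h₂ hZ hD0 hsep

/-- ★★★★ **THE η-UNIFORM, DECAYING DECOUPLING — Ϯ-l's STATEMENT, PART Ϣ's BOUND, THE ZERO MODE ABSORBED** (`c = L²`, `(ℤ∕LM₀)⁴`, endpoints of `Z₁`, `Z₂` at torus distance `≥ D ≥ 0`):
`|ln det M(U₁+U₂−U₀) − ln det M(U₁) − ln det M(U₂) + ln det M(U₀)| ≤ 16|n|⁴·((34016 + 10∕m²)∕(1+D²))²·#Z₁·#Z₂` for EVERY `L ≥ 1` and EVERY volume `M₀ ≥ 1` — a pure inverse-fourth-power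
law in the separation (if both supports are non-empty then `D ≤ tdistT ≤ LM₀∕2`, so the zero mode `8∕(m²L²M₀⁴) ≤ 10∕(m²(1+D²))`; if one is empty the left side vanishes). Compare Ϯ-l
(`16L⁴|n|⁴[(2∕m²)C_per e^{−κ_FD∕4}]²`, not η-uniform) and Ϯ-n's η-uniform face (`16|n|⁴(5∕4+1∕m²)²`, no decay). In physical units `D = L·D_phys`: `O(η⁴∕D_phys⁴)` per bond pair.
[cite: King1986, (2.13) p.653, (3.94)–(3.96) p.669, (4.4) p.670; Balaban1985BackgroundPropagators, (3.42) p.397, Thm 3.4 p.400] -/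
theorem abs_log_det_covLapF_decoupling_powerLaw_tdistT_eta_uniform :
    |Real.log (covLapF (fine L (cM M₀)) ((L : ℝ) ^ 2) m2 (U₁ + U₂ - U₀)).det - Real.log (covLapF (fine L (cM M₀)) ((L : ℝ) ^ 2) m2 U₁).det
        - Real.log (covLapF (fine L (cM M₀)) ((L : ℝ) ^ 2) m2 U₂).det + Real.log (covLapF (fine L (cM M₀)) ((L : ℝ) ^ 2) m2 U₀).det|
      ≤ 16 * (Fintype.card n : ℝ) ^ 4 * ((34016 + 10 / m2) / (1 + D ^ 2)) ^ 2 * Z₁.card * Z₂.card := by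
  have hL1 : (1 : ℝ) ≤ L := by exact_mod_cast Nat.one_le_iff_ne_zero.mpr (NeZero.ne L)
  have hM1 : (1 : ℝ) ≤ M₀ := by exact_mod_cast Nat.one_le_iff_ne_zero.mpr (NeZero.ne M₀)
  by_cases hne : Z₁.Nonempty ∧ Z₂.Nonempty
  · obtain ⟨⟨b₁, hb₁⟩, ⟨b₂, hb₂⟩⟩ := hne
    have hD : D ≤ tdistT (fine L (cM M₀)) b₁.1 b₂.1 := hsep _ _ ⟨b₁, hb₁, Or.inl rfl⟩ ⟨b₂, hb₂, Or.inl rfl⟩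
    have hDK : D ≤ ((L : ℝ) * M₀) / 2 := hD.trans (tdistT_fine_le_half L M₀ b₁.1 b₂.1)
    have h := abs_log_det_covLapF_decoupling_powerLaw_eta_uniform L M₀ hm hU₀ hU₁ hU₂ h₁ h₂ hZ hD0
      (fun x y hx hy => exists_coord_ge_of_le_tdistT (fine L (cM M₀)) (hsep x y hx hy))
    refine h.trans ?_
    -- the zero mode against `1∕(1+D²)`
    have hK1 : (1 : ℝ) ≤ (L : ℝ) * M₀ := one_le_mul_of_one_le_of_one_le hL1 hM1
    have h3 := inv_sq_le_of_le_half hK1 hD0 hDK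
    have h4 : 8 / (m2 * (L : ℝ) ^ 2 * (M₀ : ℝ) ^ 4) ≤ 8 / m2 * (1 / ((L : ℝ) * M₀) ^ 2) := by
      rw [div_mul_eq_mul_div, mul_one_div, div_div]
      apply div_le_div_of_nonneg_left (by norm_num) (by positivity)
      have : (M₀ : ℝ) ^ 2 ≤ (M₀ : ℝ) ^ 4 := by nlinarith [one_le_pow₀ hM1 (n := 2)]
      nlinarith [mul_le_mul_of_nonneg_left this (by positivity : (0:ℝ) ≤ m2 * (L : ℝ) ^ 2)]
    have hzm : 8 / (m2 * (L : ℝ) ^ 2 * (M₀ : ℝ) ^ 4) ≤ (10 / m2) / (1 + D ^ 2) := by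
      calc 8 / (m2 * (L : ℝ) ^ 2 * (M₀ : ℝ) ^ 4) ≤ 8 / m2 * (1 / ((L : ℝ) * M₀) ^ 2) := h4
        _ ≤ 8 / m2 * ((5 / 4) / (1 + D ^ 2)) := mul_le_mul_of_nonneg_left h3 (by positivity)
        _ = (10 / m2) / (1 + D ^ 2) := by ring
    have hA0 : 0 ≤ 34016 / (1 + D ^ 2) + 8 / (m2 * (L : ℝ) ^ 2 * (M₀ : ℝ) ^ 4) := by positivity
    have hAB : 34016 / (1 + D ^ 2) + 8 / (m2 * (L : ℝ) ^ 2 * (M₀ : ℝ) ^ 4) ≤ (34016 + 10 / m2) / (1 + D ^ 2) := by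
      rw [show (34016 + 10 / m2) / (1 + D ^ 2) = 34016 / (1 + D ^ 2) + (10 / m2) / (1 + D ^ 2) by ring]
      linarith
    have hsq := pow_le_pow_left₀ hA0 hAB 2
    have hZZ : (0 : ℝ) ≤ (Z₁.card : ℝ) * Z₂.card := by positivity
    have hn : (0 : ℝ) ≤ 16 * (Fintype.card n : ℝ) ^ 4 := by positivity
    calc 16 * (Fintype.card n : ℝ) ^ 4 * (34016 / (1 + D ^ 2) + 8 / (m2 * (L : ℝ) ^ 2 * (M₀ : ℝ) ^ 4)) ^ 2 * Z₁.card * Z₂.card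
        = 16 * (Fintype.card n : ℝ) ^ 4 * (34016 / (1 + D ^ 2) + 8 / (m2 * (L : ℝ) ^ 2 * (M₀ : ℝ) ^ 4)) ^ 2 * ((Z₁.card : ℝ) * Z₂.card) := by ring
      _ ≤ 16 * (Fintype.card n : ℝ) ^ 4 * ((34016 + 10 / m2) / (1 + D ^ 2)) ^ 2 * ((Z₁.card : ℝ) * Z₂.card) :=
          mul_le_mul_of_nonneg_right (mul_le_mul_of_nonneg_left hsq hn) hZZ
      _ = _ := by ring
  · -- one of the supports is empty: the left-hand side vanishes
    rw [not_and_or] at hne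
    rcases hne with h0 | h0 <;> rw [Finset.not_nonempty_iff_eq_empty] at h0
    · have e1 : U₁ = U₀ := funext fun b => h₁ b (by rw [h0]; exact Finset.notMem_empty b)
      have e12 : U₁ + U₂ - U₀ = U₂ := by rw [e1]; abel
      rw [e12, e1, h0, Finset.card_empty]
      simp
    · have e2 : U₂ = U₀ := funext fun b => h₂ b (by rw [h0]; exact Finset.notMem_empty b)
      have e12 : U₁ + U₂ - U₀ = U₁ := by rw [e2]; abel
      rw [e12, e2, h0, Finset.card_empty]
      simp

end DecouplingKing

end Summit.QuantumFields.YangMills.BalabanUVNodes.N15KingModelRung.HeatKernel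

end
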